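import Literature.NumberTheory.Automorphic.Liu2021.SplitPlaceHeckeEigenvaluesGlobal
import Literature.NumberTheory.Automorphic.Liu2021.SplitPlaceHeckeEigenvaluesAtLine
import Literature.NumberTheory.Automorphic.Liu2021.Def411WeilCarriersChiUnitary
import Literature.NumberTheory.GelbartRogawski1991.LocalSplittingCMGaloisTransport
import HarnessLib

/-!
# The `hloc` socket of «S4c-G» filled by «S4c-L», θ-generic: the CM package's local eigen-equations in S4c-G's own spelling

Topic `Literature/NumberTheory/Automorphic/Liu2021`; proof file (two theorems: no definition, no named fact, no instance, no `sorry`);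
count-neutral.  Written for the d6 line of cell `hodgecm-mathlib` (S4 assembly); HC_CM is NOT proved by anything here.

★ `Def411WeilCarriers.rhoVAtLine_congr_heckeTAt_apply_eq_smul` («S4c-G») quantifies its local hypothesis `hloc` over the carrier
spelled `TwistedCoinv.rep χ_v (𝓢.omegaLoc v) (commute_omegaLoc_localCenter … 𝓢 v) ∘ localLineInl v` for a family `𝓢` of local
splittings; ★ `Liu2021.splitPlace_heckeOperator_localInt_apply_localSplittingCM_comp_localLineInl` («S4c-L») proves the two
eigen-equations for a bare section `s` with `hs : s = localSplittingCM … θ hθ v`, the carrier spelled `((MpPsi.toRep (localSchrodinger …)).comp s).comp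
(localCenter …)`.  The two spellings agree definitionally (`FinLocalSplittings.omegaLoc`, `show … from`), but comparing them at the
INSTANTIATED `θ`-package costs ≈ 1.4 M heartbeats per equation (A-p06 (g15) census); here the comparison is made ONCE with `𝓢` a
VARIABLE (≈ 0.7 M per equation), so that every consumer instantiates `𝓢 := congrW … (undoubledSplittings … θ 𝔪 (cmFinLocalFamily … θ hθ 𝔪))`
with `hs := congrW_undoubledSplittings_cmFinLocalFamily_s …` SYNTACTICALLY:

* `splitPlace_hloc_omegaLoc_T₁` — `T_{w,1} y = √q_w (θ_w(ϖ) + χ′(ϖ) θ_w(ϖ)⁻¹) • y`;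
* `splitPlace_hloc_omegaLoc_T₂` — `T_{w,2} y = χ′(ϖ) • y`;

for any unitary oscillator character `θ`, any uniformising element `ϖ` (operators at `Units.mk0 ϖ _`, as in S4c-L), any local reading
`χ′` of the centre character (`hχ′`; `χ′ = χ̌_w` by ★ `forall_localComponent_checkOfChi_det`), at a split `w ∣ v` with the rank-2
frame `finProdFinEquiv : Fin 2 × Fin 1 ≃ Fin 2`.  The label-specialised twins (`θ = μᶜ`, `valueAtUniformizer` currency) are ★
`SplitPlaceHeckeEigenvaluesGlobalLabels`.

## References
* Y. Liu, *Fourier–Jacobi cycles and arithmetic relative trace formula*, Camb. J. Math. 9 (2021): App. D, Lemma D.1 (2) and its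
  proof, first paragraph (l. 5241, p. 126); Def. 4.11 (l. 2092–2096). [Liu2021]
* S. Gelbart, J. Rogawski, Invent. Math. 105 (1991), §3.2 p. 457. [GelbartRogawski1991]
* P. Cartier, PSPM 33 (1979), part 1, §IV.1. [CartierCorvallis1979]
-/

set_option autoImplicit false

noncomputable section

open scoped Matrix Kronecker TensorProduct Classical RestrictedProduct MatrixGroups
open NumberField NumberField.mixedEmbedding IsDedekindDomain Filter Set MulAction
open Literature.NumberTheory Literature.NumberTheory.Automorphic Literature.NumberTheory.Automorphic.UnitaryGroup
open Literature.NumberTheory.GelbartRogawski1991 Literature.NumberTheory.GelbartRogawski1991.UnitaryDualPair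
open Literature.NumberTheory.GelbartRogawski1991.UnitaryDualPair.WeilCoinv
open Literature.NumberTheory.GelbartRogawski1991.UnitaryDualPair.LocalSplitting
open Literature.NumberTheory.GelbartRogawski1991.GRConstruction
open Literature.NumberTheory.Weil1964 Literature.RepresentationTheory
open Literature.RepresentationTheory.HeisenbergGroup
open Literature.NumberTheory.GaloisRepresentations Literature.RepresentationTheory.HarrisKudlaSweet1996
open Literature.NumberTheory.Automorphic.Liu2021.Def411WeilCarriersDoubling

namespace Literature.NumberTheory.Automorphic.Liu2021.Def411WeilCarriers

set_option maxHeartbeats 2000000 in -- measured class 1.3 M: statement ≈ 180 k + ★ S4c-L application ≈ 430 k + ONE definitional re-spelling ≈ 700 k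
/-- **S4c-G's `hloc` socket, operator `T_{w,1}`, θ-generic**: for a VARIABLE family `𝓢` of local splittings over the line datum
`(diag dJ, J_W a)` whose section at `v` is THE CM section (`hs`), on every `U(diag dJ)(𝒪_v)`-fixed `y` of the local central
`χ_v`-coinvariants of `𝓢.omegaLoc v` along `localLineInl v`: `T_{w,1} y = √q_w (θ_w(ϖ) + χ′(ϖ) θ_w(ϖ)⁻¹) • y` — ★ S4c-L moved across
the definitional re-spelling once. [cite: Liu2021, App. D, Lemma D.1 (2) and proof of Lemma D.1, first paragraph (l. 5241, p. 126)]
[cite: GelbartRogawski1991, §3.2 p. 457] [cite: CartierCorvallis1979, §IV.1] -/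
theorem splitPlace_hloc_omegaLoc_T₁
    (L : Type) [Field L] [NumberField L] [IsCMField L]
    (dJ : Fin 2 → L) (hdJ : ∀ i, IsCMField.complexConj L (dJ i) = dJ i) (hdJ0 : ∀ i, dJ i ≠ 0)
    (θ : HeckeCharacter L) (hθ : IsSplittingChar L 1 θ) (hθu : θ.IsUnitary)
    (a : (Fp L)ˣ) (χ : Chi (Fp L) L (IsCMField.complexConj L))
    (hJ' : ((Matrix.diagonal dJ).map (IsCMField.complexConj L))ᵀ = Matrix.diagonal dJ)
    (𝓢 : LocalSplitting.FinLocalSplittings (Fp L) L (IsCMField.complexConj L) 2 (complexConj_imagUnit L) (imagUnit_ne_zero L)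
      (imagUnit_mul_self L) (gram (Fp L) (finProdFinEquiv : Fin 2 × Fin 1 ≃ Fin 2) (realDiagonal L dJ hdJ) (TW (Fp L) a))
      (isSymm_gram (Fp L) (finProdFinEquiv : Fin 2 × Fin 1 ≃ Fin 2) (realDiagonal_isSymm L dJ hdJ) (isSymm_TW (Fp L) a))
      (reindex_kronecker_eq_gram_map (Fp L) L (finProdFinEquiv : Fin 2 × Fin 1 ≃ Fin 2) (realDiagonal_map L dJ hdJ).symm
        (JW_eq (Fp L) L a)))
    (v : HeightOneSpectrum (𝓞 (Fp L))) (w : UnitaryGroup.PlacesOver L v) (hw : IsCMField.complexConj L • w.1 ≠ w.1)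
    (hJ'w : IsUnit (placeForm (Matrix.diagonal dJ) w.1))
    (hJ₂w : IsUnit (placeForm
      (Matrix.reindex (finProdFinEquiv : Fin 2 × Fin 1 ≃ Fin 2) finProdFinEquiv (Matrix.diagonal dJ ⊗ₖ JW (Fp L) L a)) w.1))
    (hJ₂i : hJ₂w.unit ∈ glInt 2 (w.1.adicCompletion L))
    (hs : 𝓢.s v = localSplittingCM L 2
      (isSymm_gram (Fp L) (finProdFinEquiv : Fin 2 × Fin 1 ≃ Fin 2) (realDiagonal_isSymm L dJ hdJ) (isSymm_TW (Fp L) a))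
      (isUnit_det_gram (Fp L) (finProdFinEquiv : Fin 2 × Fin 1 ≃ Fin 2) (isUnit_det_realDiagonal L dJ hdJ hdJ0)
        (isUnit_det_TW (Fp L) a))
      (reindex_kronecker_eq_gram_map (Fp L) L (finProdFinEquiv : Fin 2 × Fin 1 ≃ Fin 2) (realDiagonal_map L dJ hdJ).symm
        (JW_eq (Fp L) L a))
      θ hθ v)
    (χ' : (w.1.adicCompletion L)ˣ →* ℂˣ)
    (hχ' : ∀ z : localPi L (IsCMField.complexConj L) 1 (JW (Fp L) L a) v,
      χ' (Matrix.GeneralLinearGroup.det ((z : UnitaryGroup.LocalGLPi L 1 v) w)) =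
        localCharOfCenter (Fp L) L (IsCMField.complexConj L) (JW (Fp L) L a) (JW_apply_ne_zero (Fp L) L a) χ.1 v z)
    {ϖ : w.1.adicCompletion L} (hϖ : IsUniformizingElement ϖ) :
    ∀ y ∈ Representation.fixedPoints
        (show Representation ℂ (localPi L (IsCMField.complexConj L) 2 (Matrix.diagonal dJ) v) _ from
          (TwistedCoinv.rep (localCharOfCenter (Fp L) L (IsCMField.complexConj L) (JW (Fp L) L a)
            (JW_apply_ne_zero (Fp L) L a) χ.1 v) (𝓢.omegaLoc v)
          (commute_omegaLoc_localCenter (Fp L) L (IsCMField.complexConj L) 2 (finProdFinEquiv : Fin 2 × Fin 1 ≃ Fin 2)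
            (Matrix.diagonal dJ) (JW (Fp L) L a) (complexConj_imagUnit L) (imagUnit_ne_zero L) (imagUnit_mul_self L)
            (realDiagonal_isSymm L dJ hdJ) (isSymm_TW (Fp L) a) (realDiagonal_map L dJ hdJ).symm (JW_eq (Fp L) L a)
            (JW_apply_ne_zero (Fp L) L a) 𝓢 v)).comp
            (localLineInl L (IsCMField.complexConj L) 2 (finProdFinEquiv : Fin 2 × Fin 1 ≃ Fin 2) (Matrix.diagonal dJ)
              (JW (Fp L) L a) v))
        (localInt L (IsCMField.complexConj L) 2 (Matrix.diagonal dJ) v),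
      heckeOperator
          (show Representation ℂ (localPi L (IsCMField.complexConj L) 2 (Matrix.diagonal dJ) v) _ from
            (TwistedCoinv.rep (localCharOfCenter (Fp L) L (IsCMField.complexConj L) (JW (Fp L) L a)
              (JW_apply_ne_zero (Fp L) L a) χ.1 v) (𝓢.omegaLoc v)
            (commute_omegaLoc_localCenter (Fp L) L (IsCMField.complexConj L) 2 (finProdFinEquiv : Fin 2 × Fin 1 ≃ Fin 2)
              (Matrix.diagonal dJ) (JW (Fp L) L a) (complexConj_imagUnit L) (imagUnit_ne_zero L) (imagUnit_mul_self L)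
              (realDiagonal_isSymm L dJ hdJ) (isSymm_TW (Fp L) a) (realDiagonal_map L dJ hdJ).symm (JW_eq (Fp L) L a)
              (JW_apply_ne_zero (Fp L) L a) 𝓢 v)).comp
              (localLineInl L (IsCMField.complexConj L) 2 (finProdFinEquiv : Fin 2 × Fin 1 ≃ Fin 2) (Matrix.diagonal dJ)
                (JW (Fp L) L a) v))
          (localInt L (IsCMField.complexConj L) 2 (Matrix.diagonal dJ) v)
          ((localPiSplitEquiv (IsCMField.complexConj L) (Matrix.diagonal dJ) (IsCMField.complexConj_ne_one L) hJ' w hw hJ'w).symm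
            (heckeDiag 2 (Units.mk0 ϖ hϖ.ne_zero) 1)) y =
        ((Real.sqrt (GaloisRepresentations.IsNonarchimedeanLocalField.residueFieldCard (w.1.adicCompletion L)) : ℂ) *
          ((((θ.localComponent w.1) (Units.mk0 ϖ hϖ.ne_zero) : ℂˣ) : ℂ) +
            ((χ' (Units.mk0 ϖ hϖ.ne_zero) : ℂˣ) : ℂ) *
              ((((θ.localComponent w.1) (Units.mk0 ϖ hϖ.ne_zero) : ℂˣ) : ℂ))⁻¹)) • y := by
  intro y hy
  -- the doubled form is `F`-rational symmetric, hence hermitian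
  have hJr := reindex_kronecker_eq_gram_map (Fp L) L (finProdFinEquiv : Fin 2 × Fin 1 ≃ Fin 2)
    (realDiagonal_map L dJ hdJ).symm (JW_eq (Fp L) L a)
  have hJh : ((Matrix.reindex (finProdFinEquiv : Fin 2 × Fin 1 ≃ Fin 2) finProdFinEquiv
        (Matrix.diagonal dJ ⊗ₖ JW (Fp L) L a)).map (IsCMField.complexConj L))ᵀ =
      Matrix.reindex (finProdFinEquiv : Fin 2 × Fin 1 ≃ Fin 2) finProdFinEquiv (Matrix.diagonal dJ ⊗ₖ JW (Fp L) L a) := by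
    rw [hJr, Matrix.map_map, ← Matrix.transpose_map,
      (isSymm_gram (Fp L) (finProdFinEquiv : Fin 2 × Fin 1 ≃ Fin 2) (realDiagonal_isSymm L dJ hdJ) (isSymm_TW (Fp L) a)).eq]
    exact congrArg _ (funext fun r => (IsCMField.complexConj L).commutes r)
  have h := splitPlace_heckeOperator_localInt_apply_localSplittingCM_comp_localLineInl L (IsCMField.complexConj_ne_one L)
      (Matrix.diagonal dJ) (JW (Fp L) L a) (JW_apply_ne_zero (Fp L) L a)
      (gram (Fp L) (finProdFinEquiv : Fin 2 × Fin 1 ≃ Fin 2) (realDiagonal L dJ hdJ) (TW (Fp L) a))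
      (isSymm_gram (Fp L) (finProdFinEquiv : Fin 2 × Fin 1 ≃ Fin 2) (realDiagonal_isSymm L dJ hdJ) (isSymm_TW (Fp L) a))
      (isUnit_det_gram (Fp L) (finProdFinEquiv : Fin 2 × Fin 1 ≃ Fin 2) (isUnit_det_realDiagonal L dJ hdJ hdJ0)
        (isUnit_det_TW (Fp L) a))
      _ (gram_realDiagonal_TW L (finProdFinEquiv : Fin 2 × Fin 1 ≃ Fin 2) dJ hdJ a) hJr hJ' hJh v w hw hJ'w hJ₂w hJ₂i θ hθ hθu _ hs
      (localCharOfCenter (Fp L) L (IsCMField.complexConj L) (JW (Fp L) L a) (JW_apply_ne_zero (Fp L) L a) χ.1 v)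
      (norm_localCharOfCenter (Fp L) L (IsCMField.complexConj L) (JW (Fp L) L a) (JW_apply_ne_zero (Fp L) L a)
        (norm_chi_apply_eq_one_cm L χ) v)
      (continuous_coe_localCharOfCenter (Fp L) L (IsCMField.complexConj L) (JW (Fp L) L a) (JW_apply_ne_zero (Fp L) L a)
        χ.2.1 v) χ' hχ' hϖ (y := y) hy
  -- ONE definitional re-spelling (`omegaLoc`, `show … from`) — no `rw` on the carrier
  exact h.1

set_option maxHeartbeats 2000000 in -- measured class 1.3 M (as `_T₁`)
/-- **S4c-G's `hloc` socket, operator `T_{w,2}`, θ-generic**: same data, `T_{w,2} y = χ′(ϖ) • y`.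
[cite: Liu2021, App. D, Lemma D.1 (2) and proof of Lemma D.1, first paragraph (l. 5241, p. 126)]
[cite: GelbartRogawski1991, §3.2 p. 457] [cite: CartierCorvallis1979, §IV.1] -/
theorem splitPlace_hloc_omegaLoc_T₂
    (L : Type) [Field L] [NumberField L] [IsCMField L]
    (dJ : Fin 2 → L) (hdJ : ∀ i, IsCMField.complexConj L (dJ i) = dJ i) (hdJ0 : ∀ i, dJ i ≠ 0)
    (θ : HeckeCharacter L) (hθ : IsSplittingChar L 1 θ) (hθu : θ.IsUnitary)
    (a : (Fp L)ˣ) (χ : Chi (Fp L) L (IsCMField.complexConj L))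
    (hJ' : ((Matrix.diagonal dJ).map (IsCMField.complexConj L))ᵀ = Matrix.diagonal dJ)
    (𝓢 : LocalSplitting.FinLocalSplittings (Fp L) L (IsCMField.complexConj L) 2 (complexConj_imagUnit L) (imagUnit_ne_zero L)
      (imagUnit_mul_self L) (gram (Fp L) (finProdFinEquiv : Fin 2 × Fin 1 ≃ Fin 2) (realDiagonal L dJ hdJ) (TW (Fp L) a))
      (isSymm_gram (Fp L) (finProdFinEquiv : Fin 2 × Fin 1 ≃ Fin 2) (realDiagonal_isSymm L dJ hdJ) (isSymm_TW (Fp L) a))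
      (reindex_kronecker_eq_gram_map (Fp L) L (finProdFinEquiv : Fin 2 × Fin 1 ≃ Fin 2) (realDiagonal_map L dJ hdJ).symm
        (JW_eq (Fp L) L a)))
    (v : HeightOneSpectrum (𝓞 (Fp L))) (w : UnitaryGroup.PlacesOver L v) (hw : IsCMField.complexConj L • w.1 ≠ w.1)
    (hJ'w : IsUnit (placeForm (Matrix.diagonal dJ) w.1))
    (hJ₂w : IsUnit (placeForm
      (Matrix.reindex (finProdFinEquiv : Fin 2 × Fin 1 ≃ Fin 2) finProdFinEquiv (Matrix.diagonal dJ ⊗ₖ JW (Fp L) L a)) w.1))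
    (hJ₂i : hJ₂w.unit ∈ glInt 2 (w.1.adicCompletion L))
    (hs : 𝓢.s v = localSplittingCM L 2
      (isSymm_gram (Fp L) (finProdFinEquiv : Fin 2 × Fin 1 ≃ Fin 2) (realDiagonal_isSymm L dJ hdJ) (isSymm_TW (Fp L) a))
      (isUnit_det_gram (Fp L) (finProdFinEquiv : Fin 2 × Fin 1 ≃ Fin 2) (isUnit_det_realDiagonal L dJ hdJ hdJ0)
        (isUnit_det_TW (Fp L) a))
      (reindex_kronecker_eq_gram_map (Fp L) L (finProdFinEquiv : Fin 2 × Fin 1 ≃ Fin 2) (realDiagonal_map L dJ hdJ).symm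
        (JW_eq (Fp L) L a))
      θ hθ v)
    (χ' : (w.1.adicCompletion L)ˣ →* ℂˣ)
    (hχ' : ∀ z : localPi L (IsCMField.complexConj L) 1 (JW (Fp L) L a) v,
      χ' (Matrix.GeneralLinearGroup.det ((z : UnitaryGroup.LocalGLPi L 1 v) w)) =
        localCharOfCenter (Fp L) L (IsCMField.complexConj L) (JW (Fp L) L a) (JW_apply_ne_zero (Fp L) L a) χ.1 v z)
    {ϖ : w.1.adicCompletion L} (hϖ : IsUniformizingElement ϖ) :
    ∀ y ∈ Representation.fixedPoints
        (show Representation ℂ (localPi L (IsCMField.complexConj L) 2 (Matrix.diagonal dJ) v) _ from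
          (TwistedCoinv.rep (localCharOfCenter (Fp L) L (IsCMField.complexConj L) (JW (Fp L) L a)
            (JW_apply_ne_zero (Fp L) L a) χ.1 v) (𝓢.omegaLoc v)
          (commute_omegaLoc_localCenter (Fp L) L (IsCMField.complexConj L) 2 (finProdFinEquiv : Fin 2 × Fin 1 ≃ Fin 2)
            (Matrix.diagonal dJ) (JW (Fp L) L a) (complexConj_imagUnit L) (imagUnit_ne_zero L) (imagUnit_mul_self L)
            (realDiagonal_isSymm L dJ hdJ) (isSymm_TW (Fp L) a) (realDiagonal_map L dJ hdJ).symm (JW_eq (Fp L) L a)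
            (JW_apply_ne_zero (Fp L) L a) 𝓢 v)).comp
            (localLineInl L (IsCMField.complexConj L) 2 (finProdFinEquiv : Fin 2 × Fin 1 ≃ Fin 2) (Matrix.diagonal dJ)
              (JW (Fp L) L a) v))
        (localInt L (IsCMField.complexConj L) 2 (Matrix.diagonal dJ) v),
      heckeOperator
          (show Representation ℂ (localPi L (IsCMField.complexConj L) 2 (Matrix.diagonal dJ) v) _ from
            (TwistedCoinv.rep (localCharOfCenter (Fp L) L (IsCMField.complexConj L) (JW (Fp L) L a)
              (JW_apply_ne_zero (Fp L) L a) χ.1 v) (𝓢.omegaLoc v)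
            (commute_omegaLoc_localCenter (Fp L) L (IsCMField.complexConj L) 2 (finProdFinEquiv : Fin 2 × Fin 1 ≃ Fin 2)
              (Matrix.diagonal dJ) (JW (Fp L) L a) (complexConj_imagUnit L) (imagUnit_ne_zero L) (imagUnit_mul_self L)
              (realDiagonal_isSymm L dJ hdJ) (isSymm_TW (Fp L) a) (realDiagonal_map L dJ hdJ).symm (JW_eq (Fp L) L a)
              (JW_apply_ne_zero (Fp L) L a) 𝓢 v)).comp
              (localLineInl L (IsCMField.complexConj L) 2 (finProdFinEquiv : Fin 2 × Fin 1 ≃ Fin 2) (Matrix.diagonal dJ)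
                (JW (Fp L) L a) v))
          (localInt L (IsCMField.complexConj L) 2 (Matrix.diagonal dJ) v)
          ((localPiSplitEquiv (IsCMField.complexConj L) (Matrix.diagonal dJ) (IsCMField.complexConj_ne_one L) hJ' w hw hJ'w).symm
            (heckeDiag 2 (Units.mk0 ϖ hϖ.ne_zero) 2)) y =
        ((χ' (Units.mk0 ϖ hϖ.ne_zero) : ℂˣ) : ℂ) • y := by
  intro y hy
  -- the doubled form is `F`-rational symmetric, hence hermitian
  have hJr := reindex_kronecker_eq_gram_map (Fp L) L (finProdFinEquiv : Fin 2 × Fin 1 ≃ Fin 2)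
    (realDiagonal_map L dJ hdJ).symm (JW_eq (Fp L) L a)
  have hJh : ((Matrix.reindex (finProdFinEquiv : Fin 2 × Fin 1 ≃ Fin 2) finProdFinEquiv
        (Matrix.diagonal dJ ⊗ₖ JW (Fp L) L a)).map (IsCMField.complexConj L))ᵀ =
      Matrix.reindex (finProdFinEquiv : Fin 2 × Fin 1 ≃ Fin 2) finProdFinEquiv (Matrix.diagonal dJ ⊗ₖ JW (Fp L) L a) := by
    rw [hJr, Matrix.map_map, ← Matrix.transpose_map,
      (isSymm_gram (Fp L) (finProdFinEquiv : Fin 2 × Fin 1 ≃ Fin 2) (realDiagonal_isSymm L dJ hdJ) (isSymm_TW (Fp L) a)).eq]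
    exact congrArg _ (funext fun r => (IsCMField.complexConj L).commutes r)
  have h := splitPlace_heckeOperator_localInt_apply_localSplittingCM_comp_localLineInl L (IsCMField.complexConj_ne_one L)
      (Matrix.diagonal dJ) (JW (Fp L) L a) (JW_apply_ne_zero (Fp L) L a)
      (gram (Fp L) (finProdFinEquiv : Fin 2 × Fin 1 ≃ Fin 2) (realDiagonal L dJ hdJ) (TW (Fp L) a))
      (isSymm_gram (Fp L) (finProdFinEquiv : Fin 2 × Fin 1 ≃ Fin 2) (realDiagonal_isSymm L dJ hdJ) (isSymm_TW (Fp L) a))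
      (isUnit_det_gram (Fp L) (finProdFinEquiv : Fin 2 × Fin 1 ≃ Fin 2) (isUnit_det_realDiagonal L dJ hdJ hdJ0)
        (isUnit_det_TW (Fp L) a))
      _ (gram_realDiagonal_TW L (finProdFinEquiv : Fin 2 × Fin 1 ≃ Fin 2) dJ hdJ a) hJr hJ' hJh v w hw hJ'w hJ₂w hJ₂i θ hθ hθu _ hs
      (localCharOfCenter (Fp L) L (IsCMField.complexConj L) (JW (Fp L) L a) (JW_apply_ne_zero (Fp L) L a) χ.1 v)
      (norm_localCharOfCenter (Fp L) L (IsCMField.complexConj L) (JW (Fp L) L a) (JW_apply_ne_zero (Fp L) L a)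
        (norm_chi_apply_eq_one_cm L χ) v)
      (continuous_coe_localCharOfCenter (Fp L) L (IsCMField.complexConj L) (JW (Fp L) L a) (JW_apply_ne_zero (Fp L) L a)
        χ.2.1 v) χ' hχ' hϖ (y := y) hy
  -- ONE definitional re-spelling (`omegaLoc`, `show … from`) — no `rw` on the carrier
  exact h.2

end Literature.NumberTheory.Automorphic.Liu2021.Def411WeilCarriers

end
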